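import Literature.AlgebraicGeometry.Resolution.BlowupAlgebraDerivations
import Literature.AlgebraicGeometry.Resolution.NodalFamilyRingSingularLocus
import Literature.AlgebraicGeometry.Resolution.BlowupChartRsop
import Literature.AlgebraicGeometry.Resolution.SymbolicPowersRsop
import Literature.AlgebraicGeometry.Resolution.RegularDerivationQuotient
import Literature.AlgebraicGeometry.Resolution.HypersurfaceTransformChart
import HarnessLib

/-!
# The charts of the blow-up of `k⟦u, v, t⟧` in `(u, v, t_a, t_{a'})` and the strict transform of `uv - t₁ ⋯ t_s`

Topic: `Literature/AlgebraicGeometry/Resolution`. Commutative algebra of the chart computation in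
the proof of de Jong 1996, Claim 4.27 (p. 76), for the named fact
`DeJong1996NodalBlowupSingularLocus` (`AlterationsNormalFormBlowupFormal.lean`):

> "We blow up the scheme `Spec k⟦u, v, t₁, …, t_{d-1}⟧/(uv - t₁ ⋯ t_s)` in the ideal
> `(u, v, t₁, t₂)`. We get four charts associated to the coordinates `u, v, t₁, t₂`. By symmetry,
> we need only deal with two of these. Chart "`u ≠ 0`". Here we have coordinates
> `u, v, t₁, …, t_{d-1}, v', t₁', t₂'` and equations `v = uv'`, `t₁ = ut₁'`, `t₂ = ut₂'` and
> `v' - t₁'t₂'t₃ ⋯ t_s = 0`. Clearly, this is smooth (…) Chart "`t₁ ≠ 0`". Here we have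
> coordinates `u, v, t₁, …, t_{d-1}, u', v', t₂'` and equations `u = t₁u'`, `v = t₁v'`,
> `t₂ = t₁t₂'` and `u'v' - t₂' t₃ ⋯ t_s = 0`."

Here the centre is `𝔓 = (u, v, t_a, t_{a'})` for any two indices `a ≠ a'` below `s` (both
orders, which covers the "symmetry" between the two `t`-charts), in the regular local ring
`P = k⟦u, v, t₁, …, t_m⟧`, and the charts are the affine blowup algebras `P[𝔓/b] ⊆ P[1/b]`
(`blowupAlgebra`, `AffineBlowupAlgebra.lean`) at `b = u` and `b = t_a`. PROVED:

* `centreSeq`, `isRsopPart_centreSeq`, `isQuasiRegular_centreSeq` — `(u, v, t_a, t_{a'})` is part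
  of a regular system of parameters of `P` (the variables are one, `isRsopPart_X`), hence
  quasi-regular, and `P/𝔓` is a regular ring; so **the chart rings `P[𝔓/b]` are regular rings**
  (`isRegularRing_chartRing`: Liu Thm. 8.1.19 (a) on the charts, `isRegularRing_blowupChart`
  transported along `reesChartEquiv`; cf. `blowupAlgebra.isRegularRing` of
  `BlowupAlgebraPresentation.lean` for centres `Ideal.span (Set.range x)`).
* `restProd` — `∏'' = ∏_{c<s, c∉{a,a'}} t_c`, with `t₁ ⋯ t_s = t_a t_{a'} ∏''`
  (`prod_eq_mul_mul_restProd`).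
* `strictTransformU = v' - t_a' t_{a'}' ∏''` and `strictTransformT = u'v' - t_{a'}' ∏''` — the
  strict transforms of `F = uv - t₁ ⋯ t_s` on the charts `b = u`, `b = t_a`, with
  `F = b² · F_b` (`algebraMap_nodalFamilyRelation_eq_U`, `…_eq_T`).
* Chart "`u ≠ 0`" is smooth: the derivation `u ∂/∂v` of `P[𝔓/u]` takes `F_u` to `1`
  (`exists_derivationU`), so `P[𝔓/u]/(F_u)` is a regular ring
  (`isRegularRing_quotient_strictTransformU`, Stacks 07PF).
* Chart "`t_a ≠ 0`": the derivations `t_a∂/∂u`, `t_a∂/∂v`, `t_a∂/∂t_{a'}` and `∂/∂t_c`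
  (`c < s`, `c ∉ {a, a'}`; plain extension, `BlowupAlgebraDerivations.lean`) take `F_t` to
  `v'`, `u'`, `-∏''` and `-t_{a'}' ∏''_{≠c}` (`exists_derivationT_u/_v/_a'/_c`); hence the
  **Jacobian conclusion** `mem_of_forall_derivation_apply_mem_T`: a prime `Q` of `P[𝔓/t_a]` into
  which every derivation takes `F_t` — e.g. the preimage of a prime of `P[𝔓/t_a]/(F_t)` at which
  that ring is not regular (Stacks 07PF, `Derivation.apply_mem_comap_of_not_isRegularLocalRing`) —
  contains `u', v'`, some `t_c` (`c < s`, `c ∉ {a, a'}`), and `t_{a'}'` or a second `t_{c'}`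
  ("Clearly the singularities are of the type described in (ii)").

## Sources

* A. J. de Jong, *Smoothness, semi-stability and alterations*, Publ. Math. IHÉS 83 (1996), 4.27,
  p. 76. [DeJong1996]
* Q. Liu, *Algebraic Geometry and Arithmetic Curves* (2002), Thm. 8.1.19 (a) — through
  `BlowupChartRegular.lean`. [Liu2002]
* The Stacks Project, Tag 07PF — through `RegularDerivationQuotient.lean`,
  `PowerSeriesRegularLocal.lean`. [StacksProject]
-/

noncomputable section

open IsLocalRing IsLocalization

namespace Literature.AlgebraicGeometry.Resolution

universe u

/-! ## A part of a regular system of parameters is quasi-regular -/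

/-- A part of a regular system of parameters is a quasi-regular sequence (Matsumura Thm. 16.2 (i)
for the full system, `isQuasiRegular_rsop_comp`). [cite: Matsumura1987, Thm. 16.2 (i)] -/
theorem IsRsopPart.isQuasiRegular {R : Type u} [CommRing R] [IsLocalRing R] {n : ℕ}
    {z : Fin n → R} (hz : IsRsopPart z) : IsQuasiRegular z := by
  haveI := hz.isRegularLocalRing
  obtain ⟨e, x, hd, hx, hxz⟩ := hz.exists_rsop
  have h := isQuasiRegular_rsop_comp hd x hx (Fin.castAdd e) (Fin.castAdd_injective n e)
  have heq : x ∘ Fin.castAdd e = z := funext fun i => hxz i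
  rwa [heq] at h

namespace DeJong1996

variable (k : Type u) [Field k] (m s : ℕ) (a a' : Fin m)

/-! ## The centre `(u, v, t_a, t_{a'})` as a sequence -/

/-- The indices `u, v, t_a, t_{a'}` of the centre, enumerated. [folklore] -/
def centreIdx : Fin 4 → Fin 2 ⊕ Fin m := ![Sum.inl 0, Sum.inl 1, Sum.inr a, Sum.inr a']

/-- The centre `(u, v, t_a, t_{a'})` of the blow-up as a sequence of elements of `k⟦u, v, t⟧`.
[cite: DeJong1996, 4.27, p. 76] -/
def centreSeq : Fin 4 → MvPowerSeries (Fin 2 ⊕ Fin m) k := fun j => MvPowerSeries.X (centreIdx m a a' j)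

/-- The enumerated indices are exactly `centreVars`. [folklore] -/
theorem range_centreIdx : Set.range (centreIdx m a a') = (centreVars m a a' : Set (Fin 2 ⊕ Fin m)) := by
  ext c
  simp only [Set.mem_range, centreVars, Finset.coe_insert, Finset.coe_singleton,
    Set.mem_insert_iff, Set.mem_singleton_iff, centreIdx]
  constructor
  · rintro ⟨j, rfl⟩
    fin_cases j <;> simp
  · rintro (rfl | rfl | rfl | rfl)
    · exact ⟨0, rfl⟩
    · exact ⟨1, rfl⟩
    · exact ⟨2, rfl⟩
    · exact ⟨3, rfl⟩

/-- `(u, v, t_a, t_{a'}) = 𝔓_{aa'}` as ideals. [folklore] -/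
theorem span_range_centreSeq :
    Ideal.span (Set.range (centreSeq k m a a')) = nodalCentrePreimage k m a a' := by
  rw [nodalCentrePreimage, ← range_centreIdx, ← Set.range_comp]
  rfl

/-- The index enumeration is injective for `a ≠ a'`. [folklore] -/
theorem centreIdx_injective (haa' : a ≠ a') : Function.Injective (centreIdx m a a') := by
  intro i j h
  fin_cases i <;> fin_cases j <;> simp_all [centreIdx]

/-- **`(u, v, t_a, t_{a'})` is part of a regular system of parameters of `k⟦u, v, t⟧`** (the
variables are one). [cite: Matsumura1987, Thm. 14.2] -/
theorem isRsopPart_centreSeq (haa' : a ≠ a') : IsRsopPart (centreSeq k m a a') := by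
  let e : Fin (Nat.card (Fin 2 ⊕ Fin m)) ≃ (Fin 2 ⊕ Fin m) := (Finite.equivFin _).symm
  have h := (isRsopPart_X k (Fin 2 ⊕ Fin m) e).comp (fun j => e.symm (centreIdx m a a' j))
    (e.symm.injective.comp (centreIdx_injective m a a' haa'))
  have heq : (fun i => (MvPowerSeries.X (e i) : MvPowerSeries (Fin 2 ⊕ Fin m) k)) ∘
      (fun j => e.symm (centreIdx m a a' j)) = centreSeq k m a a' := by
    funext j
    simp [centreSeq]
  rwa [heq] at h

/-- Hence `(u, v, t_a, t_{a'})` is a quasi-regular sequence. [cite: Matsumura1987, Thm. 16.2 (i)] -/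
theorem isQuasiRegular_centreSeq (haa' : a ≠ a') : IsQuasiRegular (centreSeq k m a a') :=
  (isRsopPart_centreSeq k m a a' haa').isQuasiRegular

/-- `k⟦u, v, t⟧/(u, v, t_a, t_{a'})` is a regular ring. [cite: Matsumura1987, Thm. 14.2] -/
theorem isRegularRing_quotient_nodalCentrePreimage (haa' : a ≠ a') :
    IsRegularRing (MvPowerSeries (Fin 2 ⊕ Fin m) k ⧸ nodalCentrePreimage k m a a') := by
  rw [← span_range_centreSeq]
  haveI := (isRsopPart_centreSeq k m a a' haa').isRegularLocalRing_quotient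
  exact isRegularRing_of_isRegularLocalRing _

/-- `k⟦u, v, t⟧` is a regular ring (instance form for this file). [folklore] -/
instance : IsRegularRing (MvPowerSeries (Fin 2 ⊕ Fin m) k) := isRegularRing_mvPowerSeries k _

/-- `k⟦u, v, t⟧` is a domain (instance form for this file). [folklore] -/
instance : IsDomain (MvPowerSeries (Fin 2 ⊕ Fin m) k) := NoZeroDivisors.to_isDomain _

/-! ## The chart rings `P[𝔓/b]` are regular domains -/

/-- The chart ring `P[𝔓/b] ⊆ P[1/b]` of the blow-up of `k⟦u, v, t⟧` along `𝔓 = (u, v, t_a, t_{a'})`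
at an element `b`. [cite: DeJong1996, 4.27, p. 76] -/
abbrev ChartRing (b : MvPowerSeries (Fin 2 ⊕ Fin m) k) : Type u :=
  blowupAlgebra (nodalCentrePreimage k m a a') b

/-- **The chart rings at the generators are regular rings** (Liu Thm. 8.1.19 (a) on the charts:
`isRegularRing_blowupChart` for the quasi-regular centre with regular quotient, transported
along `reesChartEquiv`). [cite: Liu2002, Thm. 8.1.19 (a)] -/
theorem isRegularRing_chartRing (haa' : a ≠ a') (j : Fin 4) :
    IsRegularRing (ChartRing k m a a' (centreSeq k m a a' j)) := by
  have hq := isQuasiRegular_centreSeq k m a a' haa'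
  haveI : IsRegularRing (MvPowerSeries (Fin 2 ⊕ Fin m) k ⧸ Ideal.span (Set.range (centreSeq k m a a'))) := by
    rw [span_range_centreSeq]
    exact isRegularRing_quotient_nodalCentrePreimage k m a a' haa'
  have h := isRegularRing_blowupChart (centreSeq k m a a') j hq
  have e := reesChartEquiv (I := Ideal.span (Set.range (centreSeq k m a a'))) (centreSeq k m a a' j)
    (Ideal.mem_span_range_self (f := centreSeq k m a a') (x := j))
  -- transport along `e` (the instances of the chart ring are made concrete first)
  have key : ∀ (A : Type u) [CommRing A] (C : Type u) [CommRing C],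
      IsRegularRing A → (A ≃+* C) → IsRegularRing C := fun A _ C _ _ e => IsRegularRing.of_ringEquiv e
  have := key _ _ h e
  rw [span_range_centreSeq] at this
  exact this

/-- A variable is non-zero, hence a non-zero-divisor of `k⟦u, v, t⟧`. [folklore] -/
theorem X_mem_nonZeroDivisors (c : Fin 2 ⊕ Fin m) :
    (MvPowerSeries.X c : MvPowerSeries (Fin 2 ⊕ Fin m) k) ∈
      nonZeroDivisors (MvPowerSeries (Fin 2 ⊕ Fin m) k) :=
  MvPowerSeries.X_mem_nonzeroDivisors

/-- `P[1/X_c]` is a domain. [folklore] -/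
instance isDomain_away_X (c : Fin 2 ⊕ Fin m) :
    IsDomain (Localization.Away (MvPowerSeries.X c : MvPowerSeries (Fin 2 ⊕ Fin m) k)) :=
  IsLocalization.isDomain_localization
    ((Submonoid.powers_le (P := nonZeroDivisors _)).mpr (X_mem_nonZeroDivisors k m c))

/-- The chart rings at variables are domains (subrings of `P[1/X_c]`). [folklore] -/
instance isDomain_chartRing (c : Fin 2 ⊕ Fin m) :
    IsDomain (ChartRing k m a a' (MvPowerSeries.X c)) :=
  inferInstance

/-! ## The strict transforms of `F = uv - t₁ ⋯ t_s` on the charts -/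

/-- The indices `c < s`, `c ∉ {a, a'}` of the remaining factors of `t₁ ⋯ t_s`. [folklore] -/
def restIdx : Finset (Fin m) :=
  ((Finset.univ.filter fun i : Fin m => i.val < s).erase a).erase a'

/-- `∏'' = ∏_{c<s, c∉{a,a'}} t_c ∈ k⟦u, v, t⟧`. [cite: DeJong1996, 4.27, p. 76] -/
def restProd : MvPowerSeries (Fin 2 ⊕ Fin m) k :=
  ∏ c ∈ restIdx m s a a', MvPowerSeries.X (Sum.inr c)

variable {m s a a'} in
/-- Membership in `restIdx`. [folklore] -/
theorem mem_restIdx_iff {c : Fin m} :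
    c ∈ restIdx m s a a' ↔ c.val < s ∧ c ≠ a ∧ c ≠ a' := by
  simp only [restIdx, Finset.mem_erase, Finset.mem_filter, Finset.mem_univ, true_and]
  tauto

/-- **`t₁ ⋯ t_s = t_a · t_{a'} · ∏''`** for `a ≠ a'` both `< s`. [folklore] -/
theorem prod_eq_mul_mul_restProd (haa' : a ≠ a') (ha : a.val < s) (ha' : a'.val < s) :
    ∏ i ∈ Finset.univ.filter (fun i : Fin m => i.val < s),
        (MvPowerSeries.X (Sum.inr i) : MvPowerSeries (Fin 2 ⊕ Fin m) k) =
      MvPowerSeries.X (Sum.inr a) * MvPowerSeries.X (Sum.inr a') * restProd k m s a a' := by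
  have ha₁ : a ∈ Finset.univ.filter (fun i : Fin m => i.val < s) := by simp [ha]
  have ha₂ : a' ∈ (Finset.univ.filter (fun i : Fin m => i.val < s)).erase a :=
    Finset.mem_erase.mpr ⟨fun h => haa' h.symm, by simp [ha']⟩
  rw [← Finset.mul_prod_erase _ _ ha₁, ← Finset.mul_prod_erase _ _ ha₂, mul_assoc]
  rfl

section Charts

variable {k m a a'}

/-- Shorthand: the generator `x/b` of the chart ring for one of the four centre variables
(`blowupAlgebra.gen`). [folklore] -/
abbrev cgen (b : MvPowerSeries (Fin 2 ⊕ Fin m) k) (c : Fin 2 ⊕ Fin m) (hc : c ∈ centreVars m a a') :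
    ChartRing k m a a' b :=
  blowupAlgebra.gen (nodalCentrePreimage k m a a') b (MvPowerSeries.X c)
    (X_mem_nodalCentrePreimage k hc)

variable (k m a a')

/-- The strict transform `F_u = v' - t_a' t_{a'}' ∏''` of `F` on the chart `u ≠ 0`
("`v' - t₁'t₂'t₃ ⋯ t_s`"). [cite: DeJong1996, 4.27, p. 76] -/
def strictTransformU : ChartRing k m a a' (MvPowerSeries.X (Sum.inl 0)) :=
  cgen _ (Sum.inl 1) (by simp [centreVars]) -
    cgen _ (Sum.inr a) (by simp [centreVars]) * cgen _ (Sum.inr a') (by simp [centreVars]) *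
      algebraMap (MvPowerSeries (Fin 2 ⊕ Fin m) k) _ (restProd k m s a a')

/-- The strict transform `F_t = u'v' - t_{a'}' ∏''` of `F` on the chart `t_a ≠ 0`
("`u'v' - t₂' t₃ ⋯ t_s`"). [cite: DeJong1996, 4.27, p. 76] -/
def strictTransformT : ChartRing k m a a' (MvPowerSeries.X (Sum.inr a)) :=
  cgen _ (Sum.inl 0) (by simp [centreVars]) * cgen _ (Sum.inl 1) (by simp [centreVars]) -
    cgen _ (Sum.inr a') (by simp [centreVars]) * algebraMap (MvPowerSeries (Fin 2 ⊕ Fin m) k) _ (restProd k m s a a')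

/-- In `P[1/b]`: `b² · (x/b) · (y/b) = x y`. [folklore] -/
theorem sq_mul_div_mul_div {b : MvPowerSeries (Fin 2 ⊕ Fin m) k} (x y : MvPowerSeries (Fin 2 ⊕ Fin m) k) :
    algebraMap (MvPowerSeries (Fin 2 ⊕ Fin m) k) (Localization.Away b) b ^ 2 *
        (algebraMap (MvPowerSeries (Fin 2 ⊕ Fin m) k) (Localization.Away b) x * Away.invSelf b *
          (algebraMap (MvPowerSeries (Fin 2 ⊕ Fin m) k) (Localization.Away b) y * Away.invSelf b)) =
      algebraMap (MvPowerSeries (Fin 2 ⊕ Fin m) k) (Localization.Away b) x * algebraMap (MvPowerSeries (Fin 2 ⊕ Fin m) k) (Localization.Away b) y := by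
  have h := Away.mul_invSelf (S := Localization.Away b) b
  linear_combination (algebraMap (MvPowerSeries (Fin 2 ⊕ Fin m) k) (Localization.Away b) x * algebraMap (MvPowerSeries (Fin 2 ⊕ Fin m) k) (Localization.Away b) y *
    (algebraMap (MvPowerSeries (Fin 2 ⊕ Fin m) k) (Localization.Away b) b * Away.invSelf b + 1)) * h

/-- In `P[1/b]`: `b² · (x/b) = b x`. [folklore] -/
theorem sq_mul_div {b : MvPowerSeries (Fin 2 ⊕ Fin m) k} (x : MvPowerSeries (Fin 2 ⊕ Fin m) k) :
    algebraMap (MvPowerSeries (Fin 2 ⊕ Fin m) k) (Localization.Away b) b ^ 2 * (algebraMap (MvPowerSeries (Fin 2 ⊕ Fin m) k) (Localization.Away b) x * Away.invSelf b) =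
      algebraMap (MvPowerSeries (Fin 2 ⊕ Fin m) k) (Localization.Away b) b * algebraMap (MvPowerSeries (Fin 2 ⊕ Fin m) k) (Localization.Away b) x := by
  have h := Away.mul_invSelf (S := Localization.Away b) b
  linear_combination (algebraMap (MvPowerSeries (Fin 2 ⊕ Fin m) k) (Localization.Away b) b * algebraMap (MvPowerSeries (Fin 2 ⊕ Fin m) k) (Localization.Away b) x) * h

/-- **`F = u² · F_u`** on the chart `u ≠ 0`. [cite: DeJong1996, 4.27, p. 76] -/
theorem algebraMap_nodalFamilyRelation_eq_U (haa' : a ≠ a') (ha : a.val < s) (ha' : a'.val < s) :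
    algebraMap (MvPowerSeries (Fin 2 ⊕ Fin m) k) (ChartRing k m a a' (MvPowerSeries.X (Sum.inl 0)))
        (nodalFamilyRelation k m s) =
      algebraMap (MvPowerSeries (Fin 2 ⊕ Fin m) k) _ (MvPowerSeries.X (Sum.inl 0)) ^ 2 *
        strictTransformU k m s a a' := by
  apply Subtype.ext
  simp only [Subalgebra.coe_algebraMap, Subalgebra.coe_pow, strictTransformU, Subalgebra.coe_mul,
    map_sub, map_mul, Subalgebra.coe_sub, blowupAlgebra.coe_gen, nodalFamilyRelation,
    prod_eq_mul_mul_restProd k m s a a' haa' ha ha']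
  set L := Localization.Away (MvPowerSeries.X (Sum.inl 0) : MvPowerSeries (Fin 2 ⊕ Fin m) k)
  have h := Away.mul_invSelf (S := L) (MvPowerSeries.X (Sum.inl 0) : MvPowerSeries (Fin 2 ⊕ Fin m) k)
  set U := algebraMap (MvPowerSeries (Fin 2 ⊕ Fin m) k) L (MvPowerSeries.X (Sum.inl 0))
  set ι := Away.invSelf (S := L) (MvPowerSeries.X (Sum.inl 0) : MvPowerSeries (Fin 2 ⊕ Fin m) k)
  linear_combination (algebraMap (MvPowerSeries (Fin 2 ⊕ Fin m) k) L (MvPowerSeries.X (Sum.inr a)) *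
      algebraMap (MvPowerSeries (Fin 2 ⊕ Fin m) k) L (MvPowerSeries.X (Sum.inr a')) *
      algebraMap (MvPowerSeries (Fin 2 ⊕ Fin m) k) L (restProd k m s a a') * (U * ι + 1) -
    U * algebraMap (MvPowerSeries (Fin 2 ⊕ Fin m) k) L (MvPowerSeries.X (Sum.inl 1))) * h

/-- **`F = t_a² · F_t`** on the chart `t_a ≠ 0`. [cite: DeJong1996, 4.27, p. 76] -/
theorem algebraMap_nodalFamilyRelation_eq_T (haa' : a ≠ a') (ha : a.val < s) (ha' : a'.val < s) :
    algebraMap (MvPowerSeries (Fin 2 ⊕ Fin m) k) (ChartRing k m a a' (MvPowerSeries.X (Sum.inr a)))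
        (nodalFamilyRelation k m s) =
      algebraMap (MvPowerSeries (Fin 2 ⊕ Fin m) k) _ (MvPowerSeries.X (Sum.inr a)) ^ 2 *
        strictTransformT k m s a a' := by
  apply Subtype.ext
  simp only [Subalgebra.coe_algebraMap, Subalgebra.coe_pow, strictTransformT, Subalgebra.coe_mul,
    map_sub, map_mul, Subalgebra.coe_sub, blowupAlgebra.coe_gen, nodalFamilyRelation,
    prod_eq_mul_mul_restProd k m s a a' haa' ha ha']
  set L := Localization.Away (MvPowerSeries.X (Sum.inr a) : MvPowerSeries (Fin 2 ⊕ Fin m) k)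
  have h := Away.mul_invSelf (S := L) (MvPowerSeries.X (Sum.inr a) : MvPowerSeries (Fin 2 ⊕ Fin m) k)
  set T := algebraMap (MvPowerSeries (Fin 2 ⊕ Fin m) k) L (MvPowerSeries.X (Sum.inr a))
  set ι := Away.invSelf (S := L) (MvPowerSeries.X (Sum.inr a) : MvPowerSeries (Fin 2 ⊕ Fin m) k)
  linear_combination (T * algebraMap (MvPowerSeries (Fin 2 ⊕ Fin m) k) L (MvPowerSeries.X (Sum.inr a')) *
      algebraMap (MvPowerSeries (Fin 2 ⊕ Fin m) k) L (restProd k m s a a') -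
    algebraMap (MvPowerSeries (Fin 2 ⊕ Fin m) k) L (MvPowerSeries.X (Sum.inl 0)) *
      algebraMap (MvPowerSeries (Fin 2 ⊕ Fin m) k) L (MvPowerSeries.X (Sum.inl 1)) * (T * ι + 1)) * h

end Charts

/-! ## Derivations of the chart rings and their values on the strict transforms -/

section Derivations

variable {k m a a'}

/-- A generator `x/b` with `x = 0` is `0`. [folklore] -/
theorem cgen_eq_zero_of_eq {b : MvPowerSeries (Fin 2 ⊕ Fin m) k} {x : MvPowerSeries (Fin 2 ⊕ Fin m) k}
    (hx : x ∈ nodalCentrePreimage k m a a') (h0 : x = 0) :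
    blowupAlgebra.gen (nodalCentrePreimage k m a a') b x hx = 0 :=
  Subtype.ext (by simp [h0])

/-- `∂/∂X_i` preserves the centre `𝔓 = (u, v, t_a, t_{a'})` when `i` is none of its indices.
[folklore] -/
theorem pderiv_mem_nodalCentrePreimage {i : Fin 2 ⊕ Fin m} (hi : i ∉ centreVars m a a')
    {x : MvPowerSeries (Fin 2 ⊕ Fin m) k} (hx : x ∈ nodalCentrePreimage k m a a') :
    MvPowerSeries.pderiv i x ∈ nodalCentrePreimage k m a a' := by
  classical
  refine Derivation.apply_mem_span_of_forall _ (fun g hg => ?_) hx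
  obtain ⟨c, hc, rfl⟩ := hg
  rw [MvPowerSeries.pderiv_X, if_neg (fun h : c = i => hi (h ▸ hc))]
  exact Ideal.zero_mem _

variable {s} in
/-- `∂ ∏'' /∂X_i = 0` for `i` not among the `t_c`, `c ∈ restIdx`. [folklore] -/
theorem pderiv_restProd_eq_zero {i : Fin 2 ⊕ Fin m} (hi : ∀ c ∈ restIdx m s a a', Sum.inr c ≠ i) :
    MvPowerSeries.pderiv i (restProd k m s a a') = 0 := by
  classical
  exact MvPowerSeries.pderiv_prod_X_eq_zero _ _ hi

variable {s} in
/-- `∂ ∏'' /∂t_c = ∏''_{≠c}` for `c ∈ restIdx`. [folklore] -/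
theorem pderiv_restProd {c : Fin m} (hc : c ∈ restIdx m s a a') :
    MvPowerSeries.pderiv (Sum.inr c) (restProd k m s a a') =
      ∏ j ∈ (restIdx m s a a').erase c, MvPowerSeries.X (Sum.inr j) := by
  classical
  exact MvPowerSeries.pderiv_prod_X _ Sum.inr Sum.inr_injective.injOn hc

variable (k m a a')

/-- **Chart `u ≠ 0`: the derivation `u ∂/∂v` takes `F_u` to `1`.** [cite: DeJong1996, 4.27, p. 76] -/
theorem exists_derivationU :
    ∃ D : Derivation k (ChartRing k m a a' (MvPowerSeries.X (Sum.inl 0)))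
      (ChartRing k m a a' (MvPowerSeries.X (Sum.inl 0))), D (strictTransformU k m s a a') = 1 := by
  classical
  obtain ⟨D, hD⟩ := exists_derivation_blowupAlgebra (I := nodalCentrePreimage k m a a')
    (a := (MvPowerSeries.X (Sum.inl 0) : MvPowerSeries (Fin 2 ⊕ Fin m) k)) k
    (MvPowerSeries.pderiv (Sum.inl 1))
  refine ⟨D, ?_⟩
  have hgen := fun (c : Fin 2 ⊕ Fin m) (hc : c ∈ centreVars m a a') =>
    Derivation.blowupAlgebra_apply_gen D hD (MvPowerSeries.X c) (X_mem_nodalCentrePreimage k hc)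
  have hv : D (cgen _ (Sum.inl 1) (by simp [centreVars])) = 1 := by
    rw [hgen _ (by simp [centreVars])]
    simp [MvPowerSeries.pderiv_X]
  have hta : D (cgen _ (Sum.inr a) (by simp [centreVars])) = 0 := by
    rw [hgen _ (by simp [centreVars])]
    simp [MvPowerSeries.pderiv_X]
  have hta' : D (cgen _ (Sum.inr a') (by simp [centreVars])) = 0 := by
    rw [hgen _ (by simp [centreVars])]
    simp [MvPowerSeries.pderiv_X]
  have hrest : D (algebraMap _ _ (restProd k m s a a')) = 0 := by
    rw [hD, pderiv_restProd_eq_zero (fun c _ => Sum.inr_ne_inl), map_zero, mul_zero]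
  rw [strictTransformU, map_sub, hv, Derivation.leibniz, Derivation.leibniz, hta, hta', hrest]
  simp

/-- **Chart `u ≠ 0` is smooth: `P[𝔓/u]/(F_u)` is a regular ring** (Stacks 07PF with the
derivation `u ∂/∂v`). [cite: DeJong1996, 4.27, p. 76] -/
theorem isRegularRing_quotient_strictTransformU (haa' : a ≠ a') :
    IsRegularRing (ChartRing k m a a' (MvPowerSeries.X (Sum.inl 0)) ⧸
      Ideal.span {strictTransformU k m s a a'}) := by
  obtain ⟨D, hD⟩ := exists_derivationU k m s a a'
  haveI : IsRegularRing (ChartRing k m a a' (MvPowerSeries.X (Sum.inl 0))) :=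
    isRegularRing_chartRing k m a a' haa' 0
  exact isRegularRing_quotient_of_derivation _ D (by rw [hD, map_one]; exact isUnit_one)

/-- **Chart `t_a ≠ 0`: the derivation `t_a ∂/∂u` takes `F_t` to `v'`.** [cite: DeJong1996, 4.27, p. 76] -/
theorem exists_derivationT_u :
    ∃ D : Derivation k (ChartRing k m a a' (MvPowerSeries.X (Sum.inr a)))
      (ChartRing k m a a' (MvPowerSeries.X (Sum.inr a))),
        D (strictTransformT k m s a a') = cgen _ (Sum.inl 1) (by simp [centreVars]) := by
  classical
  obtain ⟨D, hD⟩ := exists_derivation_blowupAlgebra (I := nodalCentrePreimage k m a a')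
    (a := (MvPowerSeries.X (Sum.inr a) : MvPowerSeries (Fin 2 ⊕ Fin m) k)) k
    (MvPowerSeries.pderiv (Sum.inl 0))
  refine ⟨D, ?_⟩
  have hgen := fun (c : Fin 2 ⊕ Fin m) (hc : c ∈ centreVars m a a') =>
    Derivation.blowupAlgebra_apply_gen D hD (MvPowerSeries.X c) (X_mem_nodalCentrePreimage k hc)
  have hu : D (cgen _ (Sum.inl 0) (by simp [centreVars])) = 1 := by
    rw [hgen _ (by simp [centreVars])]
    simp [MvPowerSeries.pderiv_X]
  have hv : D (cgen _ (Sum.inl 1) (by simp [centreVars])) = 0 := by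
    rw [hgen _ (by simp [centreVars])]
    simp [MvPowerSeries.pderiv_X]
  have hta' : D (cgen _ (Sum.inr a') (by simp [centreVars])) = 0 := by
    rw [hgen _ (by simp [centreVars])]
    simp [MvPowerSeries.pderiv_X]
  have hrest : D (algebraMap _ _ (restProd k m s a a')) = 0 := by
    rw [hD, pderiv_restProd_eq_zero (fun c _ => Sum.inr_ne_inl), map_zero, mul_zero]
  rw [strictTransformT, map_sub, Derivation.leibniz, Derivation.leibniz, hu, hv, hta', hrest]
  simp

/-- **Chart `t_a ≠ 0`: the derivation `t_a ∂/∂v` takes `F_t` to `u'`.** [cite: DeJong1996, 4.27, p. 76] -/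
theorem exists_derivationT_v :
    ∃ D : Derivation k (ChartRing k m a a' (MvPowerSeries.X (Sum.inr a)))
      (ChartRing k m a a' (MvPowerSeries.X (Sum.inr a))),
        D (strictTransformT k m s a a') = cgen _ (Sum.inl 0) (by simp [centreVars]) := by
  classical
  obtain ⟨D, hD⟩ := exists_derivation_blowupAlgebra (I := nodalCentrePreimage k m a a')
    (a := (MvPowerSeries.X (Sum.inr a) : MvPowerSeries (Fin 2 ⊕ Fin m) k)) k
    (MvPowerSeries.pderiv (Sum.inl 1))
  refine ⟨D, ?_⟩
  have hgen := fun (c : Fin 2 ⊕ Fin m) (hc : c ∈ centreVars m a a') =>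
    Derivation.blowupAlgebra_apply_gen D hD (MvPowerSeries.X c) (X_mem_nodalCentrePreimage k hc)
  have hu : D (cgen _ (Sum.inl 0) (by simp [centreVars])) = 0 := by
    rw [hgen _ (by simp [centreVars])]
    simp [MvPowerSeries.pderiv_X]
  have hv : D (cgen _ (Sum.inl 1) (by simp [centreVars])) = 1 := by
    rw [hgen _ (by simp [centreVars])]
    simp [MvPowerSeries.pderiv_X]
  have hta' : D (cgen _ (Sum.inr a') (by simp [centreVars])) = 0 := by
    rw [hgen _ (by simp [centreVars])]
    simp [MvPowerSeries.pderiv_X]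
  have hrest : D (algebraMap _ _ (restProd k m s a a')) = 0 := by
    rw [hD, pderiv_restProd_eq_zero (fun c _ => Sum.inr_ne_inl), map_zero, mul_zero]
  rw [strictTransformT, map_sub, Derivation.leibniz, Derivation.leibniz, hu, hv, hta', hrest]
  simp

/-- **Chart `t_a ≠ 0`: the derivation `t_a ∂/∂t_{a'}` takes `F_t` to `-∏''`.**
[cite: DeJong1996, 4.27, p. 76] -/
theorem exists_derivationT_a' (haa' : a ≠ a') :
    ∃ D : Derivation k (ChartRing k m a a' (MvPowerSeries.X (Sum.inr a)))
      (ChartRing k m a a' (MvPowerSeries.X (Sum.inr a))),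
        D (strictTransformT k m s a a') = -algebraMap _ _ (restProd k m s a a') := by
  classical
  obtain ⟨D, hD⟩ := exists_derivation_blowupAlgebra (I := nodalCentrePreimage k m a a')
    (a := (MvPowerSeries.X (Sum.inr a) : MvPowerSeries (Fin 2 ⊕ Fin m) k)) k
    (MvPowerSeries.pderiv (Sum.inr a'))
  refine ⟨D, ?_⟩
  have hgen := fun (c : Fin 2 ⊕ Fin m) (hc : c ∈ centreVars m a a') =>
    Derivation.blowupAlgebra_apply_gen D hD (MvPowerSeries.X c) (X_mem_nodalCentrePreimage k hc)
  have hu : D (cgen _ (Sum.inl 0) (by simp [centreVars])) = 0 := by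
    rw [hgen _ (by simp [centreVars])]
    simp [MvPowerSeries.pderiv_X, haa']
  have hv : D (cgen _ (Sum.inl 1) (by simp [centreVars])) = 0 := by
    rw [hgen _ (by simp [centreVars])]
    simp [MvPowerSeries.pderiv_X, haa']
  have hta' : D (cgen _ (Sum.inr a') (by simp [centreVars])) = 1 := by
    rw [hgen _ (by simp [centreVars])]
    simp [MvPowerSeries.pderiv_X, haa']
  have hrest : D (algebraMap _ _ (restProd k m s a a')) = 0 := by
    rw [hD, pderiv_restProd_eq_zero, map_zero, mul_zero]
    intro c hc h
    exact (mem_restIdx_iff.mp hc).2.2 (Sum.inr_injective h)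
  rw [strictTransformT, map_sub, Derivation.leibniz, Derivation.leibniz, hu, hv, hta', hrest]
  simp

/-- **Chart `t_a ≠ 0`: the plain derivation `∂/∂t_c` (`c ∈ restIdx`) takes `F_t` to
`-t_{a'}' · ∏''_{≠c}`.** [cite: DeJong1996, 4.27, p. 76] -/
theorem exists_derivationT_c {c : Fin m} (hc : c ∈ restIdx m s a a') :
    ∃ D : Derivation k (ChartRing k m a a' (MvPowerSeries.X (Sum.inr a)))
      (ChartRing k m a a' (MvPowerSeries.X (Sum.inr a))),
        D (strictTransformT k m s a a') = -(cgen _ (Sum.inr a') (by simp [centreVars]) *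
          algebraMap (MvPowerSeries (Fin 2 ⊕ Fin m) k) (ChartRing k m a a' (MvPowerSeries.X (Sum.inr a)))
            (∏ j ∈ (restIdx m s a a').erase c, MvPowerSeries.X (Sum.inr j))) := by
  classical
  have hc' := mem_restIdx_iff.mp hc
  have hci : (Sum.inr c : Fin 2 ⊕ Fin m) ∉ centreVars m a a' := by
    simp only [centreVars, Finset.mem_insert, Finset.mem_singleton, reduceCtorEq, Sum.inr.injEq,
      false_or, not_or]
    exact ⟨hc'.2.1, hc'.2.2⟩
  obtain ⟨D, hD, hDgen⟩ := exists_derivation_blowupAlgebra_of_apply_eq_zero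
    (I := nodalCentrePreimage k m a a') (a := (MvPowerSeries.X (Sum.inr a) : MvPowerSeries (Fin 2 ⊕ Fin m) k))
    k (MvPowerSeries.pderiv (Sum.inr c))
    (by rw [MvPowerSeries.pderiv_X, if_neg (fun h : Sum.inr a = Sum.inr c => hc'.2.1 (Sum.inr_injective h).symm)])
    (fun x hx => pderiv_mem_nodalCentrePreimage hci hx)
  refine ⟨D, ?_⟩
  have hgen0 : ∀ (d : Fin 2 ⊕ Fin m) (hd : d ∈ centreVars m a a'), D (cgen _ d hd) = 0 := by
    intro d hd
    rw [hDgen]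
    refine cgen_eq_zero_of_eq _ ?_
    rw [MvPowerSeries.pderiv_X, if_neg (fun h : d = Sum.inr c => hci (h ▸ hd))]
  have hrest : D (algebraMap _ _ (restProd k m s a a')) =
      algebraMap (MvPowerSeries (Fin 2 ⊕ Fin m) k) _
        (∏ j ∈ (restIdx m s a a').erase c, MvPowerSeries.X (Sum.inr j)) := by
    rw [hD, pderiv_restProd hc]
  rw [strictTransformT, map_sub, Derivation.leibniz, Derivation.leibniz, hgen0, hgen0, hgen0, hrest]
  simp

/-! ## The Jacobian conclusion on the chart `t_a ≠ 0` -/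

/-- **Chart `t_a ≠ 0`: necessary conditions for a singular point.** If `Q` is a prime of the
regular ring `P[𝔓/t_a]` into which EVERY `k`-derivation of `P[𝔓/t_a]` takes `F_t` — as is the
case for the preimage of a prime of `P[𝔓/t_a]/(F_t)` at which the localisation is not regular
(`Derivation.apply_mem_comap_of_not_isRegularLocalRing`, Stacks 07PF) — then `Q` contains
`u' = u/t_a`, `v' = v/t_a`, some `t_c` with `c < s`, `c ∉ {a, a'}`, and either
`t_{a'}' = t_{a'}/t_a` or a second such `t_{c'}` ("Clearly the singularities are of the type
described in (ii)"). [cite: DeJong1996, 4.27, p. 76] -/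
theorem mem_of_forall_derivation_apply_mem_T (haa' : a ≠ a')
    (Q : Ideal (ChartRing k m a a' (MvPowerSeries.X (Sum.inr a)))) [Q.IsPrime]
    (hval : ∀ D : Derivation k (ChartRing k m a a' (MvPowerSeries.X (Sum.inr a)))
      (ChartRing k m a a' (MvPowerSeries.X (Sum.inr a))), D (strictTransformT k m s a a') ∈ Q) :
    cgen _ (Sum.inl 0) (by simp [centreVars]) ∈ Q ∧
      cgen _ (Sum.inl 1) (by simp [centreVars]) ∈ Q ∧
      ∃ c ∈ restIdx m s a a',
        algebraMap (MvPowerSeries (Fin 2 ⊕ Fin m) k) (ChartRing k m a a' (MvPowerSeries.X (Sum.inr a)))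
            (MvPowerSeries.X (Sum.inr c)) ∈ Q ∧
          (cgen _ (Sum.inr a') (by simp [centreVars]) ∈ Q ∨
            ∃ c' ∈ (restIdx m s a a').erase c,
              algebraMap (MvPowerSeries (Fin 2 ⊕ Fin m) k) (ChartRing k m a a' (MvPowerSeries.X (Sum.inr a)))
                (MvPowerSeries.X (Sum.inr c')) ∈ Q) := by
  -- `v'`, `u'`
  obtain ⟨D₀, hD₀⟩ := exists_derivationT_u k m s a a'
  obtain ⟨D₁, hD₁⟩ := exists_derivationT_v k m s a a'
  have hu : cgen _ (Sum.inl 0) (by simp [centreVars]) ∈ Q := by simpa [hD₁] using hval D₁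
  have hv : cgen _ (Sum.inl 1) (by simp [centreVars]) ∈ Q := by simpa [hD₀] using hval D₀
  refine ⟨hu, hv, ?_⟩
  -- `∏'' ∈ Q`, hence some `t_c ∈ Q`
  obtain ⟨D₂, hD₂⟩ := exists_derivationT_a' k m s a a' haa'
  have hrest : algebraMap (MvPowerSeries (Fin 2 ⊕ Fin m) k)
      (ChartRing k m a a' (MvPowerSeries.X (Sum.inr a))) (restProd k m s a a') ∈ Q := by
    have := hval D₂
    rwa [hD₂, neg_mem_iff] at this
  rw [restProd, map_prod] at hrest
  obtain ⟨c, hc, hcQ⟩ := Ideal.IsPrime.prod_mem_iff.mp hrest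
  refine ⟨c, hc, hcQ, ?_⟩
  -- `t_{a'}' ∏''_{≠c} ∈ Q`
  obtain ⟨D₃, hD₃⟩ := exists_derivationT_c k m s a a' hc
  have h3 : cgen _ (Sum.inr a') (by simp [centreVars]) *
      algebraMap (MvPowerSeries (Fin 2 ⊕ Fin m) k) (ChartRing k m a a' (MvPowerSeries.X (Sum.inr a)))
        (∏ j ∈ (restIdx m s a a').erase c, MvPowerSeries.X (Sum.inr j)) ∈ Q := by
    have := hval D₃
    rwa [hD₃, neg_mem_iff] at this
  rcases Ideal.IsPrime.mem_or_mem ‹Q.IsPrime› h3 with h | h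
  · exact Or.inl h
  · right
    rw [map_prod] at h
    exact Ideal.IsPrime.prod_mem_iff.mp h

end Derivations

end DeJong1996

end Literature.AlgebraicGeometry.Resolution

end
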